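import Literature.RepresentationTheory.TwistedCoinvariants
import Literature.NumberTheory.Automorphic.CompactOpenAveraging
import HarnessLib

/-!
# Survival of a spherical vector in the twisted coinvariants of a non-compact centre (the shift criterion)

Topic `RepresentationTheory`; namespace `Literature.RepresentationTheory.TwistedCoinv` (continuing
`TwistedCoinvariants`, `TwistedCoinvariantsCompactEigenvector`).  KERNEL ONLY: theorems, 0 definitions, 0 records,
0 named facts, 0 sorry.

The compact case (`TwistedCoinvariantsCompactEigenvector`: an eigenvector of a COMPACT group survives in the
`χ`-coinvariants) does not cover a centre of the shape `Z = Z⁰ · z₀^ℤ` with `Z⁰` compact and `z₀` of infinite order —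
the centre `E_v¹ ≅ F_vˣ = 𝒪_vˣ · ϖ^ℤ` of `U(n)(F_v) ≅ GL_n(F_v)` at a SPLIT place of [Liu2021, Def. 4.11 / Lem. D.1]
(`ω(μ_v, ε_v, χ_v)`).  This file gives the criterion used there, in two generic steps.

* §1 (linear algebra) **`not_exists_shift_sub_smul_eq`** — the SHIFT CRITERION: if `b : ℤ → V` is a linearly
  independent family and `T (b j) = b (j + 1)` for all `j`, then for `λ ≠ 0` the vector `b 0` is NOT of the form
  `T u - λ • u` with `u` in the span of the `b j` (a Laurent polynomial `p` with `(X - λ) p = 1` does not exist: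
  compare the top and bottom coefficients).
* §2 (averaging) **`exists_invariant_shift_sub_smul_eq_of_mk_eq_zero`** — let `ρ` be a SMOOTH representation of a
  topological group `G` (`char k = 0`), `K ≤ G` compact open, `η : H →* G` a homomorphism from a group `H` whose
  elements are all of the form `k₀ · z₀ ^ j` with `η k₀ ∈ K` and `χ k₀ = 1` (`χ : H →* kˣ`), and suppose `ρ (η z₀)`
  commutes with `ρ(K)`.  If a `K`-fixed vector `f` DIES in the `χ`-coinvariants of `ρ ∘ η`
  (`TwistedCoinv.mk (ρ.comp η) χ f = 0`), then `f = ρ(η z₀) u - χ(z₀) • u` for some `K`-FIXED `u` — apply the averaging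
  projector `e_K` of the tree's `CompactOpenAveraging` ([BernsteinZelevinsky1976, §2.3]; [Casselman1995, §2.1]) to a
  relation `f = Σ (ρ(η h_i) w_i - χ h_i • w_i)`: `e_K` fixes `f`, absorbs `ρ(η k₀)`, commutes with `T = ρ(η z₀)`
  (`avgProj_comm_of_commute`), and `T^j - λ^j ∈ (T - λ) · k[T^{±1}]`.
* §3 **`mk_ne_zero_of_shift`** — the two together: if moreover the `K`-fixed vectors lie in the span of a linearly
  independent family `b` with `b 0 = f` and `ρ(η z₀) (b j) = b (j+1)` («the spherical vectors form the free
  `k[T^{±1}]`-module on `f`»), then `TwistedCoinv.mk (ρ.comp η) χ f ≠ 0`.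

Consumer: the split-place half of the survival clause of [Liu2021, Def. 4.11]'s `⊗'_v ω(μ_v, ε_v, χ_v)` (tree
`Liu2021/Def411WeilCarriersSurvivalNonsplit` treats the non-split places), where `G = U(J)(F_v)`, `K = U(J)(𝒪_v)`,
`H = U(1)(F_v) = E_v¹`, `η` the centre, `f = 1_{𝒪_vᴺ}`, and the remaining LOCAL input is exactly §3's spherical
hypothesis (the `U(J)(𝒪_v)`-fixed vectors of the local Weil representation at a split unramified place are the span
of the translates of `1_{𝒪_vᴺ}` by the powers of the central uniformiser).

## References
* [BernsteinZelevinsky1976] I. N. Bernstein, A. V. Zelevinsky, Russian Math. Surveys 31 (1976), §2.3 (the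
  projector `π(e_K)`), 2.33 (Jacquet's lemma).
* [Casselman1995] W. Casselman, *Introduction to the theory of admissible representations of p-adic reductive
  groups* (1995), §2.1, §3.3.
* [Liu2021] Y. Liu, Camb. J. Math. 9 (2021) = arXiv:2102.11518, Def. 4.11 (FJcycle.tex l. 2092–2096), Lem. D.1
  (l. 5227; proof l. 5241–5245, the split case).
-/

set_option autoImplicit false

noncomputable section

open scoped BigOperators
open Literature.NumberTheory.Automorphic

namespace Literature.RepresentationTheory.TwistedCoinv

/-! ## §1. The shift criterion (Laurent polynomials: `(X - λ) p = 1` has no solution) -/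

section Shift

variable {k : Type*} [Field k] {V : Type*} [AddCommGroup V] [Module k V]

/-- **Shift criterion.**  `b : ℤ → V` linearly independent, `T (b j) = b (j + 1)` for all `j`, `λ ≠ 0`: there is NO `u`
in the span of the `b j` with `T u - λ • u = b 0`.  (Write `u = Σ a_j b_j`; then `T u - λ u = Σ_j (a_{j-1} - λ a_j) b_j`,
so `a_{j-1} - λ a_j = δ_{j,0}`; at `j = max supp a + 1` this forces `max supp a = -1`, at `j = min supp a` it forces
`min supp a = 0` — impossible.) [cite: BernsteinZelevinsky1976, §2.3] -/
theorem not_exists_shift_sub_smul_eq (T : V →ₗ[k] V) (b : ℤ → V) (hb : LinearIndependent k b)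
    (hT : ∀ j : ℤ, T (b j) = b (j + 1)) {μ : k} (hμ : μ ≠ 0) :
    ¬ ∃ u ∈ Submodule.span k (Set.range b), T u - μ • u = b 0 := by
  classical
  rintro ⟨u, hu, hTu⟩
  obtain ⟨a, rfl⟩ := Finsupp.mem_span_range_iff_exists_finsupp.1 hu
  -- `T u - μ u - b 0 = 0` as a vanishing combination `Σ_{j ∈ s} g j • b j` over a finite set `s`
  let s : Finset ℤ := a.support ∪ a.support.image (· + 1) ∪ {0}
  let g : ℤ → k := fun j => a (j - 1) - μ * a j - if j = 0 then 1 else 0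
  have hsupp : ∀ j, a j ≠ 0 → j ∈ s := fun j hj =>
    Finset.mem_union_left _ (Finset.mem_union_left _ (Finsupp.mem_support_iff.2 hj))
  have hsupp' : ∀ j, a (j - 1) ≠ 0 → j ∈ s := fun j hj =>
    Finset.mem_union_left _ (Finset.mem_union_right _
      (Finset.mem_image.2 ⟨j - 1, Finsupp.mem_support_iff.2 hj, sub_add_cancel j 1⟩))
  have h0s : (0 : ℤ) ∈ s := Finset.mem_union_right _ (Finset.mem_singleton_self 0)
  -- the three sums written over `s`
  have hsum_a : (a.sum fun i c => c • b i) = ∑ j ∈ s, a j • b j := by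
    rw [Finsupp.sum]
    exact Finset.sum_subset (fun j hj => hsupp j (Finsupp.mem_support_iff.1 hj)) fun j _ hj => by
      rw [Finsupp.notMem_support_iff.1 hj, zero_smul]
  have hsum_T : T (a.sum fun i c => c • b i) = ∑ j ∈ s, a (j - 1) • b j := by
    rw [Finsupp.sum, map_sum]
    simp_rw [map_smul, hT]
    -- reindex `i ↦ i + 1`
    have h1 : ∑ i ∈ a.support, a i • b (i + 1) = ∑ j ∈ a.support.image (· + 1), a (j - 1) • b j := by
      rw [Finset.sum_image fun x _ y _ (h : x + 1 = y + 1) => add_right_cancel h]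
      simp only [add_sub_cancel_right]
    rw [h1]
    exact Finset.sum_subset (fun j hj => Finset.mem_union_left _ (Finset.mem_union_right _ hj)) fun j _ hj => by
      have : a (j - 1) = 0 := by
        by_contra h
        exact hj (Finset.mem_image.2 ⟨j - 1, Finsupp.mem_support_iff.2 h, sub_add_cancel j 1⟩)
      rw [this, zero_smul]
  have hsum_0 : b 0 = ∑ j ∈ s, (if j = 0 then (1 : k) else 0) • b j := by
    rw [show (∑ j ∈ s, (if j = 0 then (1 : k) else 0) • b j) = ∑ j ∈ s, (if j = 0 then b j else 0) from
      Finset.sum_congr rfl fun j _ => by split_ifs <;> simp, Finset.sum_ite_eq', if_pos h0s]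
  have hzero : ∑ j ∈ s, g j • b j = 0 := by
    have h := hTu
    rw [hsum_T, hsum_a, Finset.smul_sum, hsum_0, ← sub_eq_zero, ← Finset.sum_sub_distrib, ← Finset.sum_sub_distrib] at h
    rw [← h]
    refine Finset.sum_congr rfl fun j _ => ?_
    simp only [g, sub_smul, mul_smul]
  have hg : ∀ j ∈ s, g j = 0 := (linearIndependent_iff'.1 hb) s g hzero
  -- `a ≠ 0` (else `b 0 = 0`, contradicting independence)
  have hb0 : b 0 ≠ 0 := hb.ne_zero 0
  have hane : a.support.Nonempty := by
    rw [Finset.nonempty_iff_ne_empty, Ne, Finsupp.support_eq_empty]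
    rintro rfl
    apply hb0
    rw [← hTu, Finsupp.sum_zero_index, map_zero, smul_zero, sub_zero]
  -- top coefficient: `M := max supp a`; `g (M + 1) = a M ≠ 0` unless `M + 1 = 0`
  set M := a.support.max' hane with hM
  have haM : a M ≠ 0 := Finsupp.mem_support_iff.1 (Finset.max'_mem _ _)
  have haM1 : a (M + 1) = 0 := by
    by_contra h
    have := Finset.le_max' _ _ (Finsupp.mem_support_iff.2 h)
    rw [← hM] at this
    omega
  have hM1 : M + 1 = 0 := by
    by_contra hne
    have := hg (M + 1) (hsupp' _ (by rwa [add_sub_cancel_right]))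
    simp only [g, add_sub_cancel_right, haM1, mul_zero, sub_zero, hne, if_false] at this
    exact haM this
  -- bottom coefficient: `m := min supp a`; `g m = -μ a m ≠ 0` unless `m = 0`
  set m := a.support.min' hane with hm
  have ham : a m ≠ 0 := Finsupp.mem_support_iff.1 (Finset.min'_mem _ _)
  have ham1 : a (m - 1) = 0 := by
    by_contra h
    have := Finset.min'_le _ _ (Finsupp.mem_support_iff.2 h)
    rw [← hm] at this
    omega
  have hm0 : m = 0 := by
    by_contra hne
    have := hg m (hsupp _ ham)
    simp only [g, ham1, zero_sub, hne, if_false, sub_zero, neg_eq_zero, mul_eq_zero] at this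
    exact this.elim hμ ham
  -- but `m ≤ M = -1 < 0 = m`
  have hle : m ≤ M := Finset.min'_le _ _ (Finset.max'_mem _ _)
  omega

end Shift

/-! ## §2. Averaging: a dead `K`-fixed vector is `T u - λ u` with `u` `K`-fixed -/

section Averaging

variable {k : Type*} [Field k] [CharZero k] {G : Type*} [Group G] [TopologicalSpace G] [IsTopologicalGroup G]
  {V : Type*} [AddCommGroup V] [Module k V] (ρ : Representation k G V) (K : Subgroup G)

/-- the averaging projector `e_K` commutes with every operator `ρ g` commuting with `ρ(K)` (transport the transversal
formula `avgProj_eq` through `ρ g`). [cite: Casselman1995, §2.1] -/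
theorem avgProj_apply_of_commute (hK : IsCompact (K : Set G)) (hρ : ρ.IsSmooth) {g : G}
    (hg : ∀ κ ∈ K, Commute (ρ g) (ρ κ)) (v : V) : ρ.avgProj K (ρ g v) = ρ g (ρ.avgProj K v) := by
  let T : Subgroup G := ρ.stabilizerSubgroup v ⊓ ρ.stabilizerSubgroup (ρ g v)
  have hT : IsOpen (T : Set G) := (hρ v).inter (hρ (ρ g v))
  obtain ⟨R, hR⟩ := exists_isLeftTransversal (B := K) hK hT
  have hTv : ∀ t ∈ T, ρ t v = v := fun t ht => (ρ.mem_stabilizerSubgroup v t).1 ht.1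
  have hTgv : ∀ t ∈ T, ρ t (ρ g v) = ρ g v := fun t ht => (ρ.mem_stabilizerSubgroup _ t).1 ht.2
  rw [Representation.avgProj_eq hK hT hTgv hR, Representation.avgProj_eq hK hT hTv hR, map_smul, map_sum]
  congr 1
  refine Finset.sum_congr rfl fun r hr => ?_
  have hc := hg r (hR.mem_of_mem r hr)
  rw [← Module.End.mul_apply, ← hc.eq, Module.End.mul_apply]

variable {H : Type*} [Group H] (η : H →* G) (χ : H →* kˣ) (z₀ : H)

omit [CharZero k] [TopologicalSpace G] [IsTopologicalGroup G] in
/-- every `ρ(η (z₀ ^ i))`, `i ∈ ℤ`, commutes with `ρ(K)` once `ρ(η z₀)` does (private step). [folklore] -/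
private theorem commute_zpow (hz : ∀ κ ∈ K, Commute (ρ (η z₀)) (ρ κ)) (i : ℤ) {κ : G} (hκ : κ ∈ K) :
    Commute (ρ (η (z₀ ^ i))) (ρ κ) := by
  have h1 : Commute (ρ (η z₀)) (ρ κ) := hz κ hκ
  have hmon : ∀ n : ℕ, Commute (ρ (η (z₀ ^ n))) (ρ κ) := fun n => by
    rw [map_pow, map_pow]; exact h1.pow_left n
  rcases Int.eq_nat_or_neg i with ⟨n, rfl | rfl⟩
  · rw [zpow_natCast]; exact hmon n
  · have hu1 : ρ (η (z₀ ^ (-(n : ℤ)))) * ρ (η (z₀ ^ (n : ℤ))) = 1 := by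
      rw [← map_mul, ← map_mul, ← zpow_add, neg_add_cancel, zpow_zero, map_one, map_one]
    have hu2 : ρ (η (z₀ ^ (n : ℤ))) * ρ (η (z₀ ^ (-(n : ℤ)))) = 1 := by
      rw [← map_mul, ← map_mul, ← zpow_add, add_neg_cancel, zpow_zero, map_one, map_one]
    have hn : Commute (ρ (η (z₀ ^ (n : ℤ)))) (ρ κ) := by rw [zpow_natCast]; exact hmon n
    -- `A⁻¹ B = A⁻¹ B (A A⁻¹) = A⁻¹ (A B) A⁻¹ = B A⁻¹`
    show ρ (η (z₀ ^ (-(n : ℤ)))) * ρ κ = ρ κ * ρ (η (z₀ ^ (-(n : ℤ))))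
    calc ρ (η (z₀ ^ (-(n : ℤ)))) * ρ κ
        = ρ (η (z₀ ^ (-(n : ℤ)))) * ρ κ * (ρ (η (z₀ ^ (n : ℤ))) * ρ (η (z₀ ^ (-(n : ℤ))))) := by rw [hu2, mul_one]
      _ = ρ (η (z₀ ^ (-(n : ℤ)))) * (ρ κ * ρ (η (z₀ ^ (n : ℤ)))) * ρ (η (z₀ ^ (-(n : ℤ)))) := by
        simp only [mul_assoc]
      _ = ρ (η (z₀ ^ (-(n : ℤ)))) * (ρ (η (z₀ ^ (n : ℤ))) * ρ κ) * ρ (η (z₀ ^ (-(n : ℤ)))) := by rw [hn.eq]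
      _ = ρ κ * ρ (η (z₀ ^ (-(n : ℤ)))) := by rw [← mul_assoc, hu1, one_mul]

omit [CharZero k] [TopologicalSpace G] [IsTopologicalGroup G] in
/-- for `n ≥ 0`: `T^n - λ^n = (T - λ) ∘ q_n(T)` — in the form needed: if `u` is `K`-fixed then
`ρ(η (z₀ ^ n)) u - (χ z₀)^n • u = ρ(η z₀) u' - χ z₀ • u'` for some `K`-fixed `u'` (private step).
[cite: BernsteinZelevinsky1976, §2.3] -/
private theorem exists_pow_sub_eq (hz : ∀ κ ∈ K, Commute (ρ (η z₀)) (ρ κ)) (n : ℕ) {u : V} (hu : ∀ κ ∈ K, ρ κ u = u) :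
    ∃ u' : V, (∀ κ ∈ K, ρ κ u' = u') ∧
      ρ (η (z₀ ^ n)) u - ((χ z₀ : kˣ) : k) ^ n • u = ρ (η z₀) u' - ((χ z₀ : kˣ) : k) • u' := by
  induction n with
  | zero => exact ⟨0, fun _ _ => map_zero _, by simp⟩
  | succ n ih =>
    obtain ⟨u', hu', h'⟩ := ih
    -- `T^{n+1} u - λ^{n+1} u = T (T^n u - λ^n u) + λ^n (T u - λ u) = (T - λ)(T u' + λ^n u)`
    refine ⟨ρ (η z₀) u' + ((χ z₀ : kˣ) : k) ^ n • u, fun κ hκ => ?_, ?_⟩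
    · rw [map_add, map_smul, hu κ hκ, ← Module.End.mul_apply, ← (hz κ hκ).eq, Module.End.mul_apply, hu' κ hκ]
    · have e1 : ρ (η (z₀ ^ (n + 1))) u = ρ (η z₀) (ρ (η (z₀ ^ n)) u) := by
        rw [pow_succ', map_mul, map_mul, Module.End.mul_apply]
      have e2 : ρ (η (z₀ ^ n)) u = ρ (η z₀) u' - ((χ z₀ : kˣ) : k) • u' + ((χ z₀ : kˣ) : k) ^ n • u := by
        rw [← h', sub_add_cancel]
      rw [e1, e2, map_add, map_sub, map_smul, map_smul, map_add, map_smul, pow_succ]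
      simp only [smul_add, smul_smul, mul_comm (((χ z₀ : kˣ) : k) ^ n) ((χ z₀ : kˣ) : k)]
      abel

omit [CharZero k] [TopologicalSpace G] [IsTopologicalGroup G] in
/-- the same for all integer powers: `T^{-n} - λ^{-n} = -λ^{-n} T^{-n} (T^n - λ^n)` (private step).
[cite: BernsteinZelevinsky1976, §2.3] -/
private theorem exists_zpow_sub_eq (hz : ∀ κ ∈ K, Commute (ρ (η z₀)) (ρ κ)) (j : ℤ) {u : V} (hu : ∀ κ ∈ K, ρ κ u = u) :
    ∃ u' : V, (∀ κ ∈ K, ρ κ u' = u') ∧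
      ρ (η (z₀ ^ j)) u - ((χ (z₀ ^ j) : kˣ) : k) • u = ρ (η z₀) u' - ((χ z₀ : kˣ) : k) • u' := by
  rcases Int.eq_nat_or_neg j with ⟨n, rfl | rfl⟩
  · obtain ⟨u', hu', h⟩ := exists_pow_sub_eq ρ K η χ z₀ hz n hu
    refine ⟨u', hu', ?_⟩
    rw [zpow_natCast, map_pow χ, Units.val_pow_eq_pow_val]
    exact h
  · obtain ⟨u', hu', h⟩ := exists_pow_sub_eq ρ K η χ z₀ hz n hu
    set A := ρ (η (z₀ ^ (-(n : ℤ)))) with hA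
    set lam : k := ((χ z₀ : kˣ) : k) with hlam
    have hlam0 : lam ≠ 0 := Units.ne_zero _
    refine ⟨-(lam ^ n)⁻¹ • A u', fun κ hκ => ?_, ?_⟩
    · rw [map_smul, ← Module.End.mul_apply, ← (commute_zpow ρ K η z₀ hz _ hκ).eq, Module.End.mul_apply, hu' κ hκ]
    · have hAinv : A (ρ (η (z₀ ^ n)) u) = u := by
        rw [hA, ← Module.End.mul_apply, ← map_mul, ← map_mul, ← zpow_natCast, ← zpow_add, neg_add_cancel, zpow_zero,
          map_one, map_one, Module.End.one_apply]
      have hAT : ∀ x, A (ρ (η z₀) x) = ρ (η z₀) (A x) := fun x => by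
        show (A * ρ (η z₀)) x = (ρ (η z₀) * A) x
        rw [hA]
        simp only [← map_mul]
        rw [(Commute.zpow_self z₀ _).eq]
      have hχ : ((χ (z₀ ^ (-(n : ℤ))) : kˣ) : k) = (lam ^ n)⁻¹ := by
        rw [map_zpow, zpow_neg, zpow_natCast, Units.val_inv_eq_inv_val, Units.val_pow_eq_pow_val]
      -- apply `A` to `h : T^n u - λ^n u = T u' - λ u'`
      have hAh : u - lam ^ n • A u = ρ (η z₀) (A u') - lam • A u' := by
        have := congrArg A h
        rw [map_sub, map_smul, map_sub, map_smul, hAinv] at this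
        rw [this, hAT]
      have hAh' : ρ (η z₀) (A u') = u - lam ^ n • A u + lam • A u' := by rw [hAh, sub_add_cancel]
      have hc : -(lam ^ n)⁻¹ * lam ^ n = -1 := by rw [neg_mul, inv_mul_cancel₀ (pow_ne_zero n hlam0)]
      rw [hχ, map_smul, hAh']
      simp only [smul_add, smul_sub, smul_smul, hc]
      module

/-- **Averaging step.**  `ρ` smooth, `K ≤ G` compact open, every `h ∈ H` of the form `k₀ · z₀ ^ j` with `η k₀ ∈ K` and
`χ k₀ = 1`, `ρ(η z₀)` commuting with `ρ(K)`.  If a `K`-fixed `f` has ZERO class in the `χ`-coinvariants of `ρ ∘ η`,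
then `f = ρ(η z₀) u - χ(z₀) • u` for some `K`-fixed `u`. [cite: BernsteinZelevinsky1976, §2.3] -/
theorem exists_invariant_shift_sub_smul_eq_of_mk_eq_zero (hK : IsCompact (K : Set G)) (hKo : IsOpen (K : Set G))
    (hρ : ρ.IsSmooth) (hdec : ∀ h : H, ∃ (k₀ : H) (j : ℤ), η k₀ ∈ K ∧ χ k₀ = 1 ∧ h = k₀ * z₀ ^ j)
    (hz : ∀ κ ∈ K, Commute (ρ (η z₀)) (ρ κ)) {f : V} (hf : ∀ κ ∈ K, ρ κ f = f)
    (h0 : mk ((ρ.comp η : Representation k H V)) χ f = 0) :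
    ∃ u : V, (∀ κ ∈ K, ρ κ u = u) ∧ ρ (η z₀) u - ((χ z₀ : kˣ) : k) • u = f := by
  classical
  -- the `K`-fixed vectors `V^K` and the target `W = (T - λ) V^K`, as submodules
  let VK : Submodule k V :=
    { carrier := {u | ∀ κ ∈ K, ρ κ u = u}
      add_mem' := fun {a b} ha hb κ hκ => by rw [map_add, ha κ hκ, hb κ hκ]
      zero_mem' := fun κ _ => map_zero _
      smul_mem' := fun c {a} ha κ hκ => by rw [map_smul, ha κ hκ] }
  have hVK : ∀ u, u ∈ VK ↔ ∀ κ ∈ K, ρ κ u = u := fun u => Iff.rfl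
  let Tl : V →ₗ[k] V := ρ (η z₀) - ((χ z₀ : kˣ) : k) • LinearMap.id
  let W : Submodule k V := VK.map Tl
  have hW : ∀ u, (∀ κ ∈ K, ρ κ u = u) → ρ (η z₀) u - ((χ z₀ : kˣ) : k) • u ∈ W := fun u hu =>
    ⟨u, (hVK u).2 hu, by simp [Tl]⟩
  -- the averaging projector, as a linear map
  let P : V →ₗ[k] V := ρ.avgProjLinear K hρ hK
  have hPfix : ∀ v, ∀ κ ∈ K, ρ κ (P v) = P v := fun v κ hκ => Representation.apply_avgProj hK (hρ v) hκ
  -- `P` maps the relation submodule into `W`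
  have hker : ∀ x ∈ ker ((ρ.comp η : Representation k H V)) χ, P x ∈ W := by
    intro x hx
    refine Submodule.span_induction (p := fun x _ => P x ∈ W) ?_ (by simp) (fun x y _ _ hx hy => ?_)
      (fun c x _ hx => ?_) hx
    · rintro _ ⟨⟨h, w⟩, rfl⟩
      obtain ⟨k₀, j, hk₀, hχk₀, rfl⟩ := hdec h
      -- the generator is `ρ(η k₀) (ρ(η z₀^j) w) - χ(z₀^j) • w`
      have hx' : (ρ.comp η : Representation k H V) (k₀ * z₀ ^ j) w - ((χ (k₀ * z₀ ^ j) : kˣ) : k) • w =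
          ρ (η k₀) (ρ (η (z₀ ^ j)) w) - ((χ (z₀ ^ j) : kˣ) : k) • w := by
        show ρ (η (k₀ * z₀ ^ j)) w - _ = _
        rw [map_mul η, map_mul ρ, Module.End.mul_apply, map_mul χ, hχk₀, one_mul]
      have hP1 : P (ρ (η k₀) (ρ (η (z₀ ^ j)) w)) = P (ρ (η (z₀ ^ j)) w) := by
        simp only [P, Representation.avgProjLinear_apply]
        exact Representation.avgProj_apply_of_mem hK (hρ _) hk₀
      have hP2 : P (ρ (η (z₀ ^ j)) w) = ρ (η (z₀ ^ j)) (P w) := by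
        simp only [P, Representation.avgProjLinear_apply]
        exact avgProj_apply_of_commute ρ K hK hρ (fun κ hκ => commute_zpow ρ K η z₀ hz j hκ) w
      show P ((ρ.comp η : Representation k H V) (k₀ * z₀ ^ j) w - ((χ (k₀ * z₀ ^ j) : kˣ) : k) • w) ∈ W
      rw [hx', map_sub, map_smul, hP1, hP2]
      obtain ⟨u', hu', h'⟩ := exists_zpow_sub_eq ρ K η χ z₀ hz j (hPfix w)
      rw [h']
      exact hW u' hu'
    · rw [map_add]; exact W.add_mem hx hy
    · rw [map_smul]; exact W.smul_mem c hx
  -- apply to `f`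
  have hfmem : f ∈ ker ((ρ.comp η : Representation k H V)) χ := (Submodule.Quotient.mk_eq_zero _).1 h0
  have hPf : P f = f := by
    simp only [P, Representation.avgProjLinear_apply]
    exact Representation.avgProj_of_forall_apply_eq hK hKo hf
  obtain ⟨u, huVK, hu⟩ := hker f hfmem
  rw [hPf] at hu
  exact ⟨u, (hVK u).1 huVK, by simpa [Tl] using hu⟩

/-! ## §3. The criterion -/

/-- **Survival criterion for a centre `Z⁰ · z₀^ℤ`.**  In the setting of §2, if the `K`-fixed vectors lie in the span of
a LINEARLY INDEPENDENT family `b : ℤ → V` with `b 0 = f` shifted by the central element (`ρ(η z₀) (b j) = b (j + 1)`),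
then the `K`-fixed vector `f` SURVIVES in the `χ`-coinvariants of `ρ ∘ η`: `TwistedCoinv.mk (ρ.comp η) χ f ≠ 0`.
[cite: BernsteinZelevinsky1976, §2.3] -/
theorem mk_ne_zero_of_shift (hK : IsCompact (K : Set G)) (hKo : IsOpen (K : Set G)) (hρ : ρ.IsSmooth)
    (hdec : ∀ h : H, ∃ (k₀ : H) (j : ℤ), η k₀ ∈ K ∧ χ k₀ = 1 ∧ h = k₀ * z₀ ^ j)
    (hz : ∀ κ ∈ K, Commute (ρ (η z₀)) (ρ κ)) (b : ℤ → V) (hb : LinearIndependent k b)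
    (hT : ∀ j : ℤ, ρ (η z₀) (b j) = b (j + 1)) (hfix : ∀ κ ∈ K, ρ κ (b 0) = b 0)
    (hspan : ∀ u : V, (∀ κ ∈ K, ρ κ u = u) → u ∈ Submodule.span k (Set.range b)) :
    mk ((ρ.comp η : Representation k H V)) χ (b 0) ≠ 0 := by
  intro h0
  obtain ⟨u, hu, hTu⟩ := exists_invariant_shift_sub_smul_eq_of_mk_eq_zero ρ K η χ z₀ hK hKo hρ hdec hz hfix h0
  exact not_exists_shift_sub_smul_eq (ρ (η z₀)) b hb hT (Units.ne_zero (χ z₀)) ⟨u, hspan u hu, hTu⟩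

/-! ### Transport of the spherical shift data along an intertwiner (appended) -/

omit [CharZero k] [TopologicalSpace G] [IsTopologicalGroup G] in
/-- **The shift data of `mk_ne_zero_of_shift` transport along a linear equivalence.**  Let `Φ : V ≃ₗ V'` intertwine
`T` with `T'` and carry the «spherical» predicate `P` into `P'` and `f` to a non-zero multiple `c • f'` of `f'`.  If `V'`
carries a linearly independent family `b'` with `b' 0 = f'`, `T' (b' j) = b' (j+1)` and every `P'`-vector in its span, then
`V` carries such a family for `(T, P, f)`: `b j := c • Φ⁻¹ (b' j)`.  (So the spherical hypothesis (SPH) may be verified in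
ANY model of the representation intertwined with the given one.) [cite: BernsteinZelevinsky1976, §2.3] -/
theorem exists_shift_family_of_linearEquiv {V' : Type*} [AddCommGroup V'] [Module k V'] (Φ : V ≃ₗ[k] V')
    (T : V →ₗ[k] V) (T' : V' →ₗ[k] V') (hT : ∀ u, Φ (T u) = T' (Φ u)) (P : V → Prop) (P' : V' → Prop)
    (hP : ∀ u, P u → P' (Φ u)) {f : V} {f' : V'} {c : k} (hc : c ≠ 0) (hf : Φ f = c • f') (b' : ℤ → V')
    (hb'0 : b' 0 = f') (hb'li : LinearIndependent k b') (hb'T : ∀ j : ℤ, T' (b' j) = b' (j + 1))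
    (hb'span : ∀ u', P' u' → u' ∈ Submodule.span k (Set.range b')) :
    ∃ b : ℤ → V, b 0 = f ∧ LinearIndependent k b ∧ (∀ j : ℤ, T (b j) = b (j + 1)) ∧
      ∀ u, P u → u ∈ Submodule.span k (Set.range b) := by
  -- the transported family, through the rescaled equivalence `Ψ = c⁻¹ • Φ` (so that `Ψ f = f'`)
  let Ψ : V ≃ₗ[k] V' := Φ.trans (LinearEquiv.smulOfNeZero k V' c⁻¹ (inv_ne_zero hc))
  have hΨ : ∀ u, Ψ u = c⁻¹ • Φ u := fun u => rfl
  have hΨf : Ψ f = f' := by rw [hΨ, hf, smul_smul, inv_mul_cancel₀ hc, one_smul]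
  have hΨT : ∀ u, Ψ (T u) = T' (Ψ u) := fun u => by rw [hΨ, hΨ, hT, map_smul]
  refine ⟨fun j => Ψ.symm (b' j), ?_, ?_, fun j => ?_, fun u hu => ?_⟩
  · show Ψ.symm (b' 0) = f
    rw [hb'0, ← hΨf, LinearEquiv.symm_apply_apply]
  · exact hb'li.map' Ψ.symm.toLinearMap Ψ.symm.ker
  · show T (Ψ.symm (b' j)) = Ψ.symm (b' (j + 1))
    apply Ψ.injective
    rw [hΨT, LinearEquiv.apply_symm_apply, LinearEquiv.apply_symm_apply, hb'T]
  · -- `Ψ u ∈ span b'` (a `P'`-vector up to the scalar `c⁻¹`), and `span (Ψ⁻¹ ∘ b') = Ψ⁻¹ (span b')`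
    have hu' : Ψ u ∈ Submodule.span k (Set.range b') := by
      rw [hΨ]
      exact Submodule.smul_mem _ _ (hb'span _ (hP u hu))
    have hrange : (Set.range fun j => Ψ.symm (b' j)) = Ψ.symm '' Set.range b' := by
      ext w
      simp only [Set.mem_range, Set.mem_image]
      constructor
      · rintro ⟨j, rfl⟩; exact ⟨b' j, ⟨j, rfl⟩, rfl⟩
      · rintro ⟨_, ⟨j, rfl⟩, rfl⟩; exact ⟨j, rfl⟩
    rw [hrange, ← LinearEquiv.coe_coe, ← Submodule.map_span]
    exact ⟨Ψ u, hu', Ψ.symm_apply_apply u⟩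

end Averaging

end Literature.RepresentationTheory.TwistedCoinv
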